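import Summits.QuantumFields.BalabanUV.T4Continuum.Support.NE7MinimiserC1Flat
import HarnessLib

/-!
# NE7MinActCriticalFlat — THE FLAT DATUM IS A CRITICAL POINT OF THE MINIMAL ACTION (ROAD-G114 §11 (v)): `y ↦ minAct(e^{y})` (the `(j+1)`-fold constrained minimal Wilson action over the datum
# `chart_1 y`) is differentiable at `y = 0` WITH ZERO DERIVATIVE — the effective action has no linear term at the trivial background.  Immediate from ✓ p826121
# (`minimiser_contDiffAt_flat`: `C¹` at `0`, minimisers exist nearby) and `0 = minAct(1) ≤ minAct(e^{y})` (`levelAction ≥ 0` on unitary configurations)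

Cell `pub-balaban`, rung (B)+1 sub-cell t4, lineage `b2b-balaban-t4-ne7-p1` (CRUX PROVER NE7 #1 = OWNER of BINDER row NE7), generation 114.  Memo `t4/b2b-balaban-t4-ne7-p1-g114/ROAD-G114.md` §11.
WHAT ([folklore]; 0 def, 0 sorry).  **`minAct_hasFDerivAt_zero_flat`**.
HONEST FRAMING (page 1): a corollary of landed theorems; nothing of Bałaban's asserted; NOT NE7 as a spine node, NOT NE3; spine 0∕9; finite T⁴ rung (B)+1 — NOT infinite volume, NOT mass
gap, NOT BetaPertH, NOT Clay.
-/

set_option autoImplicit false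

open scoped BigOperators Matrix Matrix.Norms.L2Operator Topology
open NormedSpace Finset Set Filter Metric

namespace Summit.QuantumFields.BalabanUV.T4Continuum.NE7MinActCriticalFlat

open Literature.MathematicalPhysics.QuantumFieldTheory.Balaban1983to89
open B7Prop1Explicit B7Prop2Explicit
open T4AveragingDeficitWall (IsUnitaryCfg)
open AveragingDeficitTorusChart (TDir chart chart_zero isUnitaryCfg_chart)
open AveragingDeficitTwoLevelPrep (skewSub)
open AveragingDeficitMultiLevelPrep (tower)
open MinimalActionLevels (levelAction_nonneg)
open MinimalActionSandwich (IsMinimiser minAct) open MinimalActionRate (sfClass)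
open MinimalActionWitness (flatCfg isMinimiser_sfClass_flatCfg levelAction_flatCfg)
open NE3FlatHessianCurl (isUnitaryCfg_flatCfg)
open NE7AdmissibleFibreLHC (chart_id_eq_chart_skewP)
open NE7MinimiserC1Flat (minimiser_contDiffAt_flat)

noncomputable section

variable {n : Type} [Fintype n] [DecidableEq n]

/-- **THE FLAT DATUM IS A CRITICAL POINT OF THE MINIMAL ACTION**: over `0 < ε ≤ ε₀`, `N ≥ 1`, every level `j+1`, `y ↦ minAct(chart_1 y)` has Fréchet derivative `0` at `y = 0`. [folklore] -/
theorem minAct_hasFDerivAt_zero_flat [Nonempty n] {L : ℕ} [NeZero L] (hL : 2 ≤ L) :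
    ∃ ε₀ : ℝ, 0 < ε₀ ∧ ∀ ε : ℝ, 0 < ε → ε ≤ ε₀ → ∀ (N : ℕ) [NeZero N], 1 ≤ N → ∀ j : ℕ,
      HasFDerivAt (fun y : ↥(skewSub 4 n N) => minAct 4 (sfClass 4 L N ε) L N (j + 1)
        (chart (ContinuousLinearMap.id ℝ (Matrix n n ℂ)) N (flatCfg : Site 4 → Fin 4 → (Matrix n n ℂ)ˣ) (y : TDir 4 n N))) (0 : ↥(skewSub 4 n N) →L[ℝ] ℝ) 0 := by
  have hL1 : 1 ≤ L := by omega
  obtain ⟨ε₀, hε₀, H⟩ := minimiser_contDiffAt_flat (n := n) hL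
  refine ⟨ε₀, hε₀, fun ε hε hεle N _ hN j => ?_⟩
  obtain ⟨Ψ, -, -, hmin, hC1⟩ := H ε hε hεle N hN j
  haveI : NeZero (L * tower L N j) := ⟨Nat.mul_ne_zero (NeZero.ne L) (AveragingDeficitMultiLevelPrep.tower_ne_zero L N j)⟩
  set f : ↥(skewSub 4 n N) → ℝ := fun y => minAct 4 (sfClass 4 L N ε) L N (j + 1)
    (chart (ContinuousLinearMap.id ℝ (Matrix n n ℂ)) N (flatCfg : Site 4 → Fin 4 → (Matrix n n ℂ)ˣ) (y : TDir 4 n N)) with hf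
  have hf0 : f 0 = 0 := by
    simp only [hf, Submodule.coe_zero, chart_zero]
    rw [(isMinimiser_sfClass_flatCfg (d := 4) (n := n) hL1 N hε.le (j + 1)).minAct_eq, levelAction_flatCfg]
  have hlocmin : IsLocalMin f 0 := by
    filter_upwards [hmin] with y hy
    rw [hf0]
    show 0 ≤ minAct 4 (sfClass 4 L N ε) L N (j + 1) (chart (ContinuousLinearMap.id ℝ (Matrix n n ℂ)) N (flatCfg : Site 4 → Fin 4 → (Matrix n n ℂ)ˣ) (y : TDir 4 n N))
    rw [hy.minAct_eq]
    refine levelAction_nonneg L N (j + 1) hL1 ?_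
    rw [chart_id_eq_chart_skewP _ (Ψ y).2]
    exact isUnitaryCfg_chart (L * tower L N j) isUnitaryCfg_flatCfg _
  have hd : HasFDerivAt f (fderiv ℝ f 0) 0 := (hC1.differentiableAt one_ne_zero).hasFDerivAt
  rwa [hlocmin.fderiv_eq_zero] at hd

end

end Summit.QuantumFields.BalabanUV.T4Continuum.NE7MinActCriticalFlat
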